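import Literature.LinearAlgebra.Matrix.UnitaryFormAdjointCayley                         -- ★ `θ_J X = J⁻¹ (X.map σ)ᵀ J` calculus (`formAdjoint_add∕sub∕mul∕one`, `formAdjoint_coe_eq_coe_inv`, `mem_unitaryGroupOfForm_iff_formAdjoint_mul_eq_one`), ★ `unitaryGroupOfForm`
import Literature.NumberTheory.Automorphic.GLnCongruenceSubgroups                        -- ★ `ValBound`, `congruenceGL`
import Mathlib.Algebra.Group.AddChar
import HarnessLib

/-!
# Crux `H413` — K2-LIT E3 «EllipticInputs», U12-h engine (Lay-U-1): THE FORM INVOLUTION `θ_J X = J⁻¹σ(X)ᵀJ` ON `M_N(E)` FOR A UNITARY GROUP `U(σ, J)` — `θ_J² = 1`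
# (`σ` involutive, `J` hermitian), `Ad(U)`-equivariance, the MASTER TRACE IDENTITY `σ(tr(XY)) = tr(θ_J X · θ_J Y)`, the splitting `X = ½(X − θX) + ½(X + θX)` into
# `𝔲 = {θ = −1}` and `𝔭 = {θ = +1}`, the SECOND-ORDER unitarity of layers `θZ + Z = −θZ·Z` (`1 + Z ∈ U`), and: for a `σ`-INVARIANT additive character `ψ` killing
# `σ`-anti-invariant scalars, `𝔭` PAIRS TRIVIALLY with `𝔲` and a layer character `χ_X` on `U` only sees `½(X − θX)` up to a quadratic term

Cell `hodgecm-mathlib`, Track B «K2-LIT», crux item `stmt-HodgeConjecture-24833` (h413), line `K2_E3_EllipticInputs`, unit U12 «HC characters», socket U12-h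
`sig_K2E3CharLocConstNearRegular` (‹#9L›), depth-halving road (memo v4 `K2/K2E3-p09/g2/MEMO-U12h-HF-bricks.v4.K2E3-p09-g2.md`: the non-split transport bricks (Lay-U)∕(Char-U)∕(N-U));
first of the U-transport files announced on the K2 bus 2026-09-03T23:46:52Z by seat K2E1b-p08 (g2) (frame conventions confirmed by K2E3-p14 (g2) 23:49:05Z: `U := unitaryGroupOfForm σ J ≤
GL (Fin N) E` over the FIELD `E = L_w`, levels `(congruenceGL N γ).subgroupOf U`); `--supports stmt-HodgeConjecture-24833 --as helper`.  THEOREMS ONLY — no `def` (`θ_J` written inline, as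
in ★ `UnitaryFormAdjointCayley`), no named fact, no instance, no notation, no `sorry`.  GENERIC: `E` a field (commutative ring where possible), `σ : E →+* E`, `J : M_N(E)`; involutivity
`σ ∘ σ = id`, hermitian symmetry `(J.map σ)ᵀ = J`, `IsUnit J.det`, `Invertible (2 : E)` as explicit hypotheses where used.  HONEST LABEL: HC_CM is proved only modulo the 7 printed
citations (2 remaining named inputs: hLiu418 = stmt-HodgeConjecture-24832, h413 = stmt-HodgeConjecture-24833) until rung 0 closes; count-neutral generic algebra.

THE MATHEMATICS [PlatonovRapinchuk1994, §2.3 (unitary groups of hermitian forms, `𝔲 = {X : σ(X)ᵀJ + JX = 0}`); Weyl1939, Ch. II §10; HarishChandra1999, §17 p. 80 (the lattice `L` and its dual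
for the form `B`)].  With `θ X := J⁻¹σ(X)ᵀJ` (an additive ANTI-homomorphism, ★):
* §1 `θ(a•X) = σ(a)•θX`; **`θ(θX) = X`** (`σ² = 1`, `J` hermitian); **`θ(gXg⁻¹) = g·θX·g⁻¹` for `g ∈ U(σ,J)`** (★ `θg = g⁻¹`); the MASTER IDENTITY **`σ(tr(XY)) = tr(θX·θY)`**, whence
  `σ(tr(XY)) = −tr(XY)` for `θX = X`, `θY = −Y` and `σ(tr(XY)) = tr(XY)` for `X, Y ∈ 𝔲`.
* §2 the projections `X⁻ := ⅟2(X − θX) ∈ 𝔲`, `X⁺ := ⅟2(X + θX) ∈ 𝔭`, `X = X⁻ + X⁺`; `Ad(g)` (`g ∈ U`) preserves `𝔲` and `𝔭`.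
* §3 LAYERS OF `U` ARE IN `𝔲` TO SECOND ORDER: `k ∈ U(σ,J)`, `Z := k − 1` ⇒ **`θZ + Z = −θZ·Z`**, i.e. `Z⁺ = −⅟2·θZ·Z`.
* §4 CHARACTERS: for `ψ : AddChar E M` with `ψ ∘ σ = ψ` and `ψ a = 1` whenever `σ a = −a` (e.g. `ψ_F ∘ tr_{E∕F}`): **`ψ(tr(XY)) = 1` for `X ∈ 𝔭`, `Y ∈ 𝔲`** — the `𝔭`-parameters are
  INVISIBLE on `𝔲` — and for `k = 1 + Z ∈ U`: **`ψ(tr(XZ)) = ψ(tr(X⁻Z)) · ψ(tr(X⁺Z⁺))`** with `Z⁺ = −⅟2 θZ·Z` quadratic, so on deep enough layers `χ_X = χ_{X⁻}`: the layer characters of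
  `U` are parametrised by `𝔲` (the input of (Char-U) ∕ (N-U)).

## References
* [PlatonovRapinchuk1994] V. Platonov, A. Rapinchuk, *Algebraic Groups and Number Theory* (1994), §2.3.
* [Weyl1939] H. Weyl, *The Classical Groups* (1939), Ch. II §10.
* [HarishChandra1999] Harish-Chandra (DeBacker–Sally), *Admissible Invariant Distributions on Reductive p-adic Groups*, ULECT 16 (1999), §17 p. 80.
-/

set_option autoImplicit false
-- the mandated namespace repeats `HodgeConjecture.HodgeConjecture`, as in every `Theorems/*.lean` of this sub-problem
set_option linter.dupNamespace false

noncomputable section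

open scoped MatrixGroups Matrix
open Literature.NumberTheory.Automorphic Literature.LinearAlgebra.Matrix

namespace Summit.HodgeConjecture.HodgeConjecture.Cruxes.H413.K2E3UnitaryLayerInvolution

variable {E : Type*} [Field E] {N : ℕ} (σ : E →+* E) {J : Matrix (Fin N) (Fin N) E}

/-! ## §1 `θ_J` is a `σ`-semilinear involution commuting with `Ad(U(σ, J))`; the master trace identity -/

/-- `θ_J (a • X) = σ(a) • θ_J X`. [cite: PlatonovRapinchuk1994, §2.3] -/
theorem formAdjoint_smul (a : E) (X : Matrix (Fin N) (Fin N) E) :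
    J⁻¹ * ((a • X).map σ)ᵀ * J = σ a • (J⁻¹ * (X.map σ)ᵀ * J) := by
  have h : (a • X).map σ = σ a • X.map σ := by
    ext i j; simp only [Matrix.map_apply, Matrix.smul_apply, smul_eq_mul, map_mul]
  rw [h, Matrix.transpose_smul, Matrix.mul_smul, Matrix.smul_mul]

/-- For a hermitian `J` (`(J.map σ)ᵀ = J`): `J.map σ = Jᵀ`. [cite: PlatonovRapinchuk1994, §2.3] -/
theorem map_eq_transpose_of_hermitian (hJ : (J.map σ)ᵀ = J) : J.map σ = Jᵀ := by
  rw [← hJ, Matrix.transpose_transpose, hJ]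

/-- For `σ` involutive and `J` hermitian with unit determinant: `(J⁻¹).map σ = (J⁻¹)ᵀ`. [cite: PlatonovRapinchuk1994, §2.3] -/
theorem map_inv_eq_transpose_inv_of_hermitian (hJ : (J.map σ)ᵀ = J) (hJu : IsUnit J.det) : (J⁻¹).map σ = (J⁻¹)ᵀ := by
  have h1 : (J⁻¹).map σ * J.map σ = 1 := by rw [← Matrix.map_mul, Matrix.nonsing_inv_mul J hJu, Matrix.map_one σ (map_zero σ) (map_one σ)]
  rw [map_eq_transpose_of_hermitian σ hJ] at h1
  rw [Matrix.transpose_nonsing_inv]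
  exact (Matrix.inv_eq_left_inv h1).symm

/-- **`θ_J (θ_J X) = X`** for `σ` involutive (`σ (σ a) = a`) and `J` hermitian with unit determinant. [cite: PlatonovRapinchuk1994, §2.3] -/
theorem formAdjoint_formAdjoint (hσ : ∀ a : E, σ (σ a) = a) (hJ : (J.map σ)ᵀ = J) (hJu : IsUnit J.det) (X : Matrix (Fin N) (Fin N) E) :
    J⁻¹ * ((J⁻¹ * (X.map σ)ᵀ * J).map σ)ᵀ * J = X := by
  have hXX : (X.map σ).map σ = X := by
    ext i j; simp only [Matrix.map_apply, hσ]
  have h1 : (J⁻¹ * (X.map σ)ᵀ * J).map σ = (J * X * J⁻¹)ᵀ := by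
    rw [Matrix.map_mul, Matrix.map_mul, map_inv_eq_transpose_inv_of_hermitian σ hJ hJu, map_eq_transpose_of_hermitian σ hJ, Matrix.transpose_map, hXX]
    simp only [Matrix.transpose_mul, Matrix.mul_assoc]
  rw [h1, Matrix.transpose_transpose]
  simp only [Matrix.mul_assoc]
  rw [Matrix.nonsing_inv_mul J hJu, Matrix.mul_one, Matrix.nonsing_inv_mul_cancel_left J _ hJu]

/-- **`Ad(U)`-EQUIVARIANCE: `θ_J (g X g⁻¹) = g · θ_J X · g⁻¹` for `g ∈ U(σ, J)`** (anti-multiplicativity ★ `formAdjoint_mul` and ★ `θ_J g = g⁻¹`). [cite: PlatonovRapinchuk1994, §2.3] -/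
theorem formAdjoint_conj_of_mem (hJu : IsUnit J.det) {g : GL (Fin N) E} (hg : g ∈ unitaryGroupOfForm σ J) (X : Matrix (Fin N) (Fin N) E) :
    J⁻¹ * (((g : Matrix (Fin N) (Fin N) E) * X * ((g⁻¹ : GL (Fin N) E) : Matrix (Fin N) (Fin N) E)).map σ)ᵀ * J =
      (g : Matrix (Fin N) (Fin N) E) * (J⁻¹ * (X.map σ)ᵀ * J) * ((g⁻¹ : GL (Fin N) E) : Matrix (Fin N) (Fin N) E) := by
  rw [formAdjoint_mul σ hJu, formAdjoint_mul σ hJu, formAdjoint_coe_eq_coe_inv σ hJu hg, formAdjoint_coe_eq_coe_inv σ hJu (Subgroup.inv_mem _ hg), inv_inv]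
  simp only [Matrix.mul_assoc]

omit σ in
/-- `tr(J⁻¹ A J) = tr A`. [folklore] -/
theorem trace_inv_mul_mul (hJu : IsUnit J.det) (A : Matrix (Fin N) (Fin N) E) : Matrix.trace (J⁻¹ * A * J) = Matrix.trace A := by
  rw [Matrix.trace_mul_cycle, Matrix.mul_nonsing_inv J hJu, Matrix.one_mul]

/-- **THE MASTER TRACE IDENTITY `σ(tr(XY)) = tr(θ_J X · θ_J Y)`** (`J` with unit determinant; no hermitian hypothesis). [cite: PlatonovRapinchuk1994, §2.3] [cite: HarishChandra1999, §17 p. 80] -/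
theorem map_trace_mul (hJu : IsUnit J.det) (X Y : Matrix (Fin N) (Fin N) E) :
    σ (Matrix.trace (X * Y)) = Matrix.trace ((J⁻¹ * (X.map σ)ᵀ * J) * (J⁻¹ * (Y.map σ)ᵀ * J)) := by
  rw [AddMonoidHom.map_trace σ, Matrix.map_mul, ← Matrix.trace_transpose, Matrix.transpose_mul,
    show J⁻¹ * (X.map σ)ᵀ * J * (J⁻¹ * (Y.map σ)ᵀ * J) = J⁻¹ * ((X.map σ)ᵀ * (Y.map σ)ᵀ) * J by
      simp only [Matrix.mul_assoc]; rw [Matrix.mul_nonsing_inv_cancel_left J _ hJu],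
    trace_inv_mul_mul hJu, Matrix.trace_mul_comm]

/-- `X ∈ 𝔭` (`θX = X`), `Y ∈ 𝔲` (`θY = −Y`) ⇒ **`σ(tr(XY)) = −tr(XY)`** (the pairing of `𝔭` with `𝔲` is `σ`-ANTI-invariant). [cite: PlatonovRapinchuk1994, §2.3] -/
theorem map_trace_mul_eq_neg (hJu : IsUnit J.det) {X Y : Matrix (Fin N) (Fin N) E} (hX : J⁻¹ * (X.map σ)ᵀ * J = X) (hY : J⁻¹ * (Y.map σ)ᵀ * J = -Y) :
    σ (Matrix.trace (X * Y)) = -Matrix.trace (X * Y) := by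
  rw [map_trace_mul σ hJu, hX, hY, Matrix.mul_neg, Matrix.trace_neg]

/-- `X, Y ∈ 𝔲` ⇒ **`σ(tr(XY)) = tr(XY)`** (the pairing on `𝔲 × 𝔲` is `σ`-invariant, i.e. `F`-valued). [cite: PlatonovRapinchuk1994, §2.3] -/
theorem map_trace_mul_eq_self (hJu : IsUnit J.det) {X Y : Matrix (Fin N) (Fin N) E} (hX : J⁻¹ * (X.map σ)ᵀ * J = -X) (hY : J⁻¹ * (Y.map σ)ᵀ * J = -Y) :
    σ (Matrix.trace (X * Y)) = Matrix.trace (X * Y) := by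
  rw [map_trace_mul σ hJu, hX, hY, Matrix.neg_mul, Matrix.mul_neg, neg_neg]

/-! ## §2 The splitting `X = X⁻ + X⁺`, `X⁻ = ⅟2(X − θX) ∈ 𝔲`, `X⁺ = ⅟2(X + θX) ∈ 𝔭` -/

section Split

variable [Invertible (2 : E)]

omit σ in
/-- `X = ⅟2(X − T) + ⅟2(X + T)`. [folklore] -/
theorem eq_half_sub_add_half_add (X T : Matrix (Fin N) (Fin N) E) : X = ⅟(2 : E) • (X - T) + ⅟(2 : E) • (X + T) := by
  rw [← smul_add, sub_add_add_cancel, ← two_smul E X, smul_smul, invOf_mul_self, one_smul]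

/-- `σ(⅟2) = ⅟2`. [folklore] -/
theorem map_invOf_two : σ (⅟(2 : E)) = ⅟(2 : E) := by
  rw [invOf_eq_inv, map_inv₀, map_ofNat]

/-- **`X⁻ := ⅟2(X − θX) ∈ 𝔲`**: `θ(X⁻) = −X⁻` (`σ` involutive, `J` hermitian). [cite: PlatonovRapinchuk1994, §2.3] -/
theorem formAdjoint_half_sub (hσ : ∀ a : E, σ (σ a) = a) (hJ : (J.map σ)ᵀ = J) (hJu : IsUnit J.det) (X : Matrix (Fin N) (Fin N) E) :
    J⁻¹ * ((⅟(2 : E) • (X - J⁻¹ * (X.map σ)ᵀ * J)).map σ)ᵀ * J = -(⅟(2 : E) • (X - J⁻¹ * (X.map σ)ᵀ * J)) := by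
  rw [formAdjoint_smul, map_invOf_two, formAdjoint_sub σ, formAdjoint_formAdjoint σ hσ hJ hJu, ← smul_neg, neg_sub]

/-- **`X⁺ := ⅟2(X + θX) ∈ 𝔭`**: `θ(X⁺) = X⁺`. [cite: PlatonovRapinchuk1994, §2.3] -/
theorem formAdjoint_half_add (hσ : ∀ a : E, σ (σ a) = a) (hJ : (J.map σ)ᵀ = J) (hJu : IsUnit J.det) (X : Matrix (Fin N) (Fin N) E) :
    J⁻¹ * ((⅟(2 : E) • (X + J⁻¹ * (X.map σ)ᵀ * J)).map σ)ᵀ * J = ⅟(2 : E) • (X + J⁻¹ * (X.map σ)ᵀ * J) := by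
  rw [formAdjoint_smul, map_invOf_two, formAdjoint_add σ, formAdjoint_formAdjoint σ hσ hJ hJu, add_comm]

end Split

/-- `Ad(g)` (`g ∈ U`) maps `𝔲` to `𝔲` and `𝔭` to `𝔭`: `θY = εY ⇒ θ(gYg⁻¹) = ε·gYg⁻¹` for `ε = ±1` — stated for `−Y` (`𝔲`). [cite: PlatonovRapinchuk1994, §2.3] -/
theorem formAdjoint_conj_eq_neg_of_mem (hJu : IsUnit J.det) {g : GL (Fin N) E} (hg : g ∈ unitaryGroupOfForm σ J) {Y : Matrix (Fin N) (Fin N) E}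
    (hY : J⁻¹ * (Y.map σ)ᵀ * J = -Y) :
    J⁻¹ * (((g : Matrix (Fin N) (Fin N) E) * Y * ((g⁻¹ : GL (Fin N) E) : Matrix (Fin N) (Fin N) E)).map σ)ᵀ * J =
      -((g : Matrix (Fin N) (Fin N) E) * Y * ((g⁻¹ : GL (Fin N) E) : Matrix (Fin N) (Fin N) E)) := by
  rw [formAdjoint_conj_of_mem σ hJu hg, hY, Matrix.mul_neg, Matrix.neg_mul]

/-- … and for `+Y` (`𝔭`). [cite: PlatonovRapinchuk1994, §2.3] -/
theorem formAdjoint_conj_eq_self_of_mem (hJu : IsUnit J.det) {g : GL (Fin N) E} (hg : g ∈ unitaryGroupOfForm σ J) {Y : Matrix (Fin N) (Fin N) E}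
    (hY : J⁻¹ * (Y.map σ)ᵀ * J = Y) :
    J⁻¹ * (((g : Matrix (Fin N) (Fin N) E) * Y * ((g⁻¹ : GL (Fin N) E) : Matrix (Fin N) (Fin N) E)).map σ)ᵀ * J =
      (g : Matrix (Fin N) (Fin N) E) * Y * ((g⁻¹ : GL (Fin N) E) : Matrix (Fin N) (Fin N) E) := by
  rw [formAdjoint_conj_of_mem σ hJu hg, hY]

/-! ## §3 Layers of `U(σ, J)` lie in `𝔲` to second order -/

/-- **SECOND-ORDER UNITARITY: for `k ∈ U(σ, J)` and `Z := k − 1`, `θZ + Z = −θZ·Z`** (from ★ `θk·k = 1` with `θk = 1 + θZ`); hence `Z⁺ = ⅟2(Z + θZ) = −⅟2·θZ·Z` is QUADRATIC in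
`Z` — the congruence layers of `U` are parametrised by `𝔲` («Cayley to second order»). [cite: Weyl1939, Ch. II §10] [cite: PlatonovRapinchuk1994, §2.3] -/
theorem formAdjoint_sub_one_add_eq (hJu : IsUnit J.det) {k : GL (Fin N) E} (hk : k ∈ unitaryGroupOfForm σ J) :
    J⁻¹ * (((k : Matrix (Fin N) (Fin N) E) - 1).map σ)ᵀ * J + ((k : Matrix (Fin N) (Fin N) E) - 1) =
      -(J⁻¹ * (((k : Matrix (Fin N) (Fin N) E) - 1).map σ)ᵀ * J) * ((k : Matrix (Fin N) (Fin N) E) - 1) := by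
  have h := (mem_unitaryGroupOfForm_iff_formAdjoint_mul_eq_one σ hJu k).1 hk
  rw [formAdjoint_sub σ, formAdjoint_one σ hJu] at *
  -- `(θk − 1)(k − 1) = θk·k − θk − k + 1 = 2 − θk − k`
  have e : (J⁻¹ * ((k : Matrix (Fin N) (Fin N) E).map σ)ᵀ * J - 1) * ((k : Matrix (Fin N) (Fin N) E) - 1) =
      J⁻¹ * ((k : Matrix (Fin N) (Fin N) E).map σ)ᵀ * J * (k : Matrix (Fin N) (Fin N) E) - J⁻¹ * ((k : Matrix (Fin N) (Fin N) E).map σ)ᵀ * J -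
        (k : Matrix (Fin N) (Fin N) E) + 1 := by noncomm_ring
  rw [neg_mul, e, h]
  abel

/-! ## §4 Characters: `𝔭` is invisible on `𝔲`; a layer character of `U` only sees the `𝔲`-part of its parameter, up to a quadratic term -/

section Character

variable {M : Type*} [CommMonoid M] (ψ : AddChar E M)

/-- **`𝔭` PAIRS TRIVIALLY WITH `𝔲` UNDER A `σ`-SYMMETRIC CHARACTER**: if `ψ` kills `σ`-anti-invariant scalars (`σ a = −a ⇒ ψ a = 1`; e.g. `ψ = ψ_F ∘ tr_{E∕F}`), then `ψ(tr(XY)) = 1` for `θX = X`,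
`θY = −Y`. [cite: HarishChandra1999, §17 p. 80] [cite: PlatonovRapinchuk1994, §2.3] -/
theorem map_trace_mul_eq_one_of_plus_minus (hanti : ∀ a : E, σ a = -a → ψ a = 1) (hJu : IsUnit J.det) {X Y : Matrix (Fin N) (Fin N) E}
    (hX : J⁻¹ * (X.map σ)ᵀ * J = X) (hY : J⁻¹ * (Y.map σ)ᵀ * J = -Y) : ψ (Matrix.trace (X * Y)) = 1 :=
  hanti _ (map_trace_mul_eq_neg σ hJu hX hY)

variable [Invertible (2 : E)]

/-- **A LAYER CHARACTER OF `U` ONLY SEES THE `𝔲`-PART OF ITS PARAMETER, UP TO A QUADRATIC TERM**: for `k ∈ U(σ,J)`, `Z = k − 1`, any `X`, and `ψ` killing `σ`-anti-invariant scalars: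
`ψ(tr(X·Z)) = ψ(tr(X⁻·Z)) · ψ(tr(X⁺·Z⁺))` with `X^∓ = ⅟2(X ∓ θX)`, `Z⁺ = ⅟2(Z + θZ) (= −⅟2 θZ·Z`, §3) — the second factor is `1` as soon as `v(X)·v(Z)² ≤` (defects), i.e. on the layers
`U ∩ K_m` with `2m ≥ depth` (the depth-halving regime). [cite: HarishChandra1999, §17 p. 80] [cite: Weyl1939, Ch. II §10] -/
theorem map_trace_mul_layer_eq (hσ : ∀ a : E, σ (σ a) = a) (hJ : (J.map σ)ᵀ = J) (hJu : IsUnit J.det) (hanti : ∀ a : E, σ a = -a → ψ a = 1)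
    (X Z : Matrix (Fin N) (Fin N) E) :
    ψ (Matrix.trace (X * Z)) =
      ψ (Matrix.trace (⅟(2 : E) • (X - J⁻¹ * (X.map σ)ᵀ * J) * Z)) * ψ (Matrix.trace (⅟(2 : E) • (X + J⁻¹ * (X.map σ)ᵀ * J) * (⅟(2 : E) • (Z + J⁻¹ * (Z.map σ)ᵀ * J)))) := by
  -- `X = X⁻ + X⁺`, `Z = Z⁻ + Z⁺`, and `tr(X⁺ Z⁻)` is killed by `ψ`
  have hX := eq_half_sub_add_half_add X (J⁻¹ * (X.map σ)ᵀ * J)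
  have hZ := eq_half_sub_add_half_add Z (J⁻¹ * (Z.map σ)ᵀ * J)
  have hkill : ψ (Matrix.trace (⅟(2 : E) • (X + J⁻¹ * (X.map σ)ᵀ * J) * (⅟(2 : E) • (Z - J⁻¹ * (Z.map σ)ᵀ * J)))) = 1 :=
    map_trace_mul_eq_one_of_plus_minus σ ψ hanti hJu (formAdjoint_half_add σ hσ hJ hJu X) (formAdjoint_half_sub σ hσ hJ hJu Z)
  conv_lhs => rw [hX, Matrix.add_mul]
  rw [Matrix.trace_add, AddChar.map_add_eq_mul]
  congr 1
  conv_lhs => rw [hZ, Matrix.mul_add]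
  rw [Matrix.trace_add, AddChar.map_add_eq_mul, hkill, one_mul]

/-- In particular for `X ∈ 𝔲` (`θX = −X`, so `X⁻ = X`, `X⁺ = 0`) NOTHING is lost: `ψ(tr(X⁻Z)) = ψ(tr(XZ))` — recorded as `X⁻ = X`. [cite: PlatonovRapinchuk1994, §2.3] -/
theorem half_sub_formAdjoint_eq_self_of_minus {X : Matrix (Fin N) (Fin N) E} (hX : J⁻¹ * (X.map σ)ᵀ * J = -X) : ⅟(2 : E) • (X - J⁻¹ * (X.map σ)ᵀ * J) = X := by
  rw [hX, sub_neg_eq_add, ← two_smul E X, smul_smul, invOf_mul_self, one_smul]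

/-- … and `X⁺ = 0` for `X ∈ 𝔲`. [cite: PlatonovRapinchuk1994, §2.3] -/
theorem half_add_formAdjoint_eq_zero_of_minus {X : Matrix (Fin N) (Fin N) E} (hX : J⁻¹ * (X.map σ)ᵀ * J = -X) : ⅟(2 : E) • (X + J⁻¹ * (X.map σ)ᵀ * J) = 0 := by
  rw [hX, add_neg_cancel, smul_zero]

end Character

end Summit.HodgeConjecture.HodgeConjecture.Cruxes.H413.K2E3UnitaryLayerInvolution

end
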